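import Mathlib
import HarnessLib

/-!
# Shell-to-shell energy transfer of an incompressible Fourier velocity field: the antisymmetry and detailed-conservation IDENTITIES behind the cell's gate G2-0

HONEST FRAMING (cell `pub-fluidc`, verbatim): *low prior, high value-of-information experiment on
Tao's machine paradigm; NOT a claim that NS blows up.* This file contains NO statement about the
Navier–Stokes or Euler evolution. It records, for an arbitrary field of Fourier coefficients
`û : ℤ³ → ℂ³` subject only to the REALITY condition `û(-k) = conj û(k)` and INCOMPRESSIBILITY
`k · û(k) = 0`, the purely algebraic identities that every shell-to-shell transfer diagnostic
must satisfy and that the cell's referee certified numerically as gate **G2-0 (identity)**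
(HOME/GATE.md §G2-0: "antisymmetry `T(m→n) = -T(n→m)` exactly (to 1e-10 relative)",
"`Π(k_n) = Σ_{m ≤ n} Σ_{n' > n} ⟨T(m→n')⟩`", "`Σ_k T = 0`").

* `modeTransfer û k p = Im[(k · û(k-p)) (conj û(k) · û(p))]` — the effective MODE-TO-MODE
  kinetic-energy transfer rate INTO mode `k` FROM mode `p`, mediated by `q = k - p`: the
  function `S^{uu}(k'|p|q) = -Im[(k'·u(q))(u(k')·u(p))]`, `k' + p + q = 0`, of
  [cite: Verma2004MHDTurbulencePhysRep, §3.1.2] / [cite: DarVermaEswaran2001, §2] written with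
  `k = -k'` and `u(k') = conj u(k)` (reality); summed over `p` it is the advective term of the
  modal energy equation `∂ₜ ½|û(k)|² = Σ_{p+q=k} Im[(k·û(q))(conj û(k)·û(p))]`
  [cite: Verma2004MHDTurbulencePhysRep, §3.1, first display] (pressure drops out by
  incompressibility).
* `shellTransfer û K P = Σ_{k∈K} Σ_{p∈P} modeTransfer û k p` — rate INTO the set of modes `K`
  FROM the set `P` (any two finite sets of wavevectors): `T^{uu}_{nm}` of
  [cite: Verma2004MHDTurbulencePhysRep, §3.2, last display]; by Parseval it is the physical-space
  `𝒯_{uu}(Q,K) = -∫ u_K·(u·∇)u_Q` of [cite: AlexakisMininniPouquet2005ShellToShellMHD, §II eq. for 𝒯_uu]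
  (the dns-A / scorer `T[K][Q]` of the cell, HOME/LITERATURE.md §C4/§C8) up to the volume factor,
  which is not formalised here.

PROVED (pure finite-sum algebra; the two hypotheses are used exactly where the printed proofs
use them — incompressibility of the MEDIATOR `k·û(k-p) = p·û(k-p)`, reality for `û(p-k)`):
* `modeTransfer_antisymm : modeTransfer û p k = -modeTransfer û k p` — "equal and opposite"
  [cite: Verma2004MHDTurbulencePhysRep, §3.1.1–3.1.2] ("satisfy the Eqs. … because of
  incompressibility condition");
* `shellTransfer_antisymm : shellTransfer û P K = -shellTransfer û K P` — the identity
  `𝒯_{vw}(Q,K) = -𝒯_{wv}(K,Q)` of [cite: AlexakisMininniPouquet2005ShellToShellMHD, §II]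
  ("can be easily shown to hold"); `shellTransfer_self : shellTransfer û K K = 0`;
* `shellTransfer_union_left/right` (additivity over disjoint shells) and the FLUX IDENTITY
  `flux_eq_shellTransfer`: for disjoint finite sets `I` ("inside the sphere") and `O` ("outside"),
  `-(Σ_{k∈I} Σ_{p∈I∪O} modeTransfer û k p) = shellTransfer û O I` — the energy lost by the
  inside to the truncated system `I ∪ O` is exactly what the outside receives from the inside
  [cite: Verma2004MHDTurbulencePhysRep, §3.3] — and DETAILED CONSERVATION
  `totalTransfer_eq_zero : Σ_{k∈S} Σ_{p∈S} modeTransfer û k p = 0` for every finite `S`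
  (the Galerkin-truncated nonlinearity conserves energy; Kraichnan's detailed conservation
  triad by triad is the case `|S| = 3` up to conjugates).

* (v2) `energyRate_eq_re_cdot_advection`: with the Galerkin-truncated advection term
  `N_S(k)_j = -i Σ_{p∈S} (k·û(k-p)) û_j(p)` (`ShellTransfer.advection`),
  `Σ_{p∈S} modeTransfer û k p = Re(conj û(k) · N_S(k))` — i.e. `energyRate` IS the advective
  `d/dt ½|û(k)|²` of the truncated system `dû(k)/dt = P_k N_S(k)`; the Leray/pressure projection
  `P_k` drops out because `conj û(k) · (c k) = 0` for every scalar `c`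
  (`cdot_conj_coeff_parallel`, `energyRate_eq_re_cdot_projected`) — "the pressure does not
  appear in the energy equation because of the incompressibility condition"
  [cite: Verma2004MHDTurbulencePhysRep, §3.1].

What is deliberately NOT here: the identification of `modeTransfer` with `-∫ u_K·(u·∇)u_Q`
(Parseval on `𝕋³`), solutions of the truncated ODE in time, helicity transfer, MHD.
No named facts (D-0026).
-/

noncomputable section

namespace Literature.Analysis.FluidPDE.FluidComputer

open Complex ComplexConjugate Finset
open scoped BigOperators

namespace ShellTransfer

/-- A field of Fourier velocity coefficients `û : ℤ³ → ℂ³` that is REAL in physical space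
(`û(-k) = conj û(k)` componentwise) and INCOMPRESSIBLE (`k · û(k) = 0`). Nothing else is assumed
(no decay, no finite support, no dynamics). [folklore] -/
structure FourierVelocity where
  /-- the Fourier coefficient `û(k) ∈ ℂ³` of the mode `k ∈ ℤ³` -/
  coeff : (Fin 3 → ℤ) → (Fin 3 → ℂ)
  /-- reality of the velocity field: `û(-k)ᵢ = conj û(k)ᵢ` -/
  reality : ∀ k i, coeff (-k) i = conj (coeff k i)
  /-- incompressibility: `Σᵢ kᵢ û(k)ᵢ = 0` -/
  divFree : ∀ k, ∑ i, ((k i : ℤ) : ℂ) * coeff k i = 0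

/-- `k · a = Σᵢ kᵢ aᵢ` for a wavevector `k ∈ ℤ³` and `a ∈ ℂ³`. [folklore] -/
def kdot (k : Fin 3 → ℤ) (a : Fin 3 → ℂ) : ℂ := ∑ i, ((k i : ℤ) : ℂ) * a i

/-- The bilinear (NOT sesquilinear) pairing `a · b = Σᵢ aᵢ bᵢ` on `ℂ³`; conjugates are written
explicitly where they occur. [folklore] -/
def cdot (a b : Fin 3 → ℂ) : ℂ := ∑ i, a i * b i

/-- **Effective mode-to-mode kinetic-energy transfer** INTO mode `k` FROM mode `p`, mediated by
`q = k - p`: `Im[(k · û(k-p)) (conj û(k) · û(p))]` — Verma's `S^{uu}(k'|p|q)`, `k' = -k`.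
[cite: Verma2004MHDTurbulencePhysRep, §3.1.2] -/
def modeTransfer (U : FourierVelocity) (k p : Fin 3 → ℤ) : ℝ :=
  (kdot k (U.coeff (k - p)) * cdot (fun i => conj (U.coeff k i)) (U.coeff p)).im

/-- **Shell-to-shell transfer** INTO the mode set `K` FROM the mode set `P`:
`Σ_{k∈K} Σ_{p∈P} modeTransfer û k p` (`T^{uu}_{nm}` with `n = K`, `m = P`).
[cite: Verma2004MHDTurbulencePhysRep, §3.2] -/
def shellTransfer (U : FourierVelocity) (K P : Finset (Fin 3 → ℤ)) : ℝ :=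
  ∑ k ∈ K, ∑ p ∈ P, modeTransfer U k p

/-- The advective energy rate of mode `k` inside the truncated system of modes `S`:
`Σ_{p∈S} modeTransfer û k p` (= `∂ₜ ½|û(k)|²` for the Galerkin truncation to `S` when `û` is
supported in `S`; that identification is not formalised). [cite: Verma2004MHDTurbulencePhysRep, §3.1] -/
def energyRate (U : FourierVelocity) (S : Finset (Fin 3 → ℤ)) (k : Fin 3 → ℤ) : ℝ :=
  ∑ p ∈ S, modeTransfer U k p

variable (U : FourierVelocity)

/-! ## Algebra of the two pairings -/

/-- `(k - p) · a = k · a - p · a`. [folklore] -/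
theorem kdot_sub (k p : Fin 3 → ℤ) (a : Fin 3 → ℂ) : kdot (k - p) a = kdot k a - kdot p a := by
  unfold kdot
  rw [← Finset.sum_sub_distrib]
  refine Finset.sum_congr rfl fun i _ => ?_
  simp only [Pi.sub_apply, Int.cast_sub]
  ring

/-- `p · conj a = conj (p · a)` (the wavevector is real). [folklore] -/
theorem kdot_conj (p : Fin 3 → ℤ) (a : Fin 3 → ℂ) :
    kdot p (fun i => conj (a i)) = conj (kdot p a) := by
  unfold kdot
  rw [map_sum]
  refine Finset.sum_congr rfl fun i _ => ?_
  rw [map_mul, map_intCast]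

/-- `conj û(p) · û(k) = conj (conj û(k) · û(p))`. [folklore] -/
theorem cdot_conj_swap (a b : Fin 3 → ℂ) :
    cdot (fun i => conj (a i)) b = conj (cdot (fun i => conj (b i)) a) := by
  unfold cdot
  rw [map_sum]
  refine Finset.sum_congr rfl fun i _ => ?_
  rw [map_mul, Complex.conj_conj]
  ring

/-- Incompressibility of the MEDIATOR: `k · û(k-p) = p · û(k-p)`. [folklore] -/
theorem kdot_mediator (k p : Fin 3 → ℤ) : kdot k (U.coeff (k - p)) = kdot p (U.coeff (k - p)) := by
  have h : kdot (k - p) (U.coeff (k - p)) = 0 := U.divFree (k - p)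
  rw [kdot_sub] at h
  exact sub_eq_zero.mp h

/-- Reality for the reversed mediator: `û(p-k) = conj û(k-p)`. [folklore] -/
theorem coeff_sub_swap (k p : Fin 3 → ℤ) : U.coeff (p - k) = fun i => conj (U.coeff (k - p) i) := by
  funext i
  rw [← U.reality (k - p) i, neg_sub]

/-! ## Antisymmetry -/

/-- **Mode-to-mode transfer is antisymmetric**: what `p` gives to `k` is what `k` receives from
`p` — `S(k|p|q) + S(p|k|q) = 0`, using incompressibility of the mediator and reality.
[cite: Verma2004MHDTurbulencePhysRep, §3.1.1–3.1.2] -/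
theorem modeTransfer_antisymm (k p : Fin 3 → ℤ) : modeTransfer U p k = -modeTransfer U k p := by
  unfold modeTransfer
  rw [coeff_sub_swap U k p, kdot_conj, ← kdot_mediator U k p, cdot_conj_swap, ← map_mul,
    Complex.conj_im]

/-- `modeTransfer û k k = 0` (a mode does not feed itself). [folklore] -/
theorem modeTransfer_self (k : Fin 3 → ℤ) : modeTransfer U k k = 0 := by
  have h := modeTransfer_antisymm U k k
  linarith

/-- **Shell-to-shell transfer is antisymmetric**: `T(P→K) = -T(K→P)` — the identity
`𝒯_{vw}(Q,K) = -𝒯_{wv}(K,Q)`. [cite: AlexakisMininniPouquet2005ShellToShellMHD, §II] -/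
theorem shellTransfer_antisymm (K P : Finset (Fin 3 → ℤ)) :
    shellTransfer U P K = -shellTransfer U K P := by
  unfold shellTransfer
  rw [Finset.sum_comm, ← Finset.sum_neg_distrib]
  refine Finset.sum_congr rfl fun k _ => ?_
  rw [← Finset.sum_neg_distrib]
  refine Finset.sum_congr rfl fun p _ => ?_
  exact modeTransfer_antisymm U k p

/-- A shell exchanges no net energy with itself: `T(K→K) = 0`. [folklore] -/
theorem shellTransfer_self (K : Finset (Fin 3 → ℤ)) : shellTransfer U K K = 0 := by
  have h := shellTransfer_antisymm U K K
  linarith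

/-- **Detailed conservation**: the total advective transfer inside ANY finite set of modes
vanishes, `Σ_{k∈S} Σ_{p∈S} modeTransfer û k p = 0` (the truncated nonlinearity conserves
kinetic energy). [cite: Verma2004MHDTurbulencePhysRep, §3.1] -/
theorem totalTransfer_eq_zero (S : Finset (Fin 3 → ℤ)) :
    ∑ k ∈ S, ∑ p ∈ S, modeTransfer U k p = 0 :=
  shellTransfer_self U S

/-- The same statement for the modal energy rates: `Σ_{k∈S} energyRate û S k = 0`. [folklore] -/
theorem sum_energyRate_eq_zero (S : Finset (Fin 3 → ℤ)) : ∑ k ∈ S, energyRate U S k = 0 :=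
  totalTransfer_eq_zero U S

/-! ## Additivity over disjoint shells and the flux identity -/

/-- Additivity in the receiving set. [folklore] -/
theorem shellTransfer_union_left (K₁ K₂ P : Finset (Fin 3 → ℤ)) (h : Disjoint K₁ K₂) :
    shellTransfer U (K₁ ∪ K₂) P = shellTransfer U K₁ P + shellTransfer U K₂ P := by
  unfold shellTransfer
  rw [Finset.sum_union h]

/-- Additivity in the giving set. [folklore] -/
theorem shellTransfer_union_right (K P₁ P₂ : Finset (Fin 3 → ℤ)) (h : Disjoint P₁ P₂) :
    shellTransfer U K (P₁ ∪ P₂) = shellTransfer U K P₁ + shellTransfer U K P₂ := by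
  unfold shellTransfer
  rw [← Finset.sum_add_distrib]
  refine Finset.sum_congr rfl fun k _ => ?_
  rw [Finset.sum_union h]

/-- **Flux identity**: for disjoint finite mode sets `I` (inside the sphere) and `O` (outside),
the energy LOST by the inside within the truncated system `I ∪ O`,
`Π := -Σ_{k∈I} energyRate û (I ∪ O) k`, equals the shell transfer received by the outside from
the inside, `T(I→O)` — the cell's `Π(k_n) = Σ_{m≤n} Σ_{n'>n} T(m→n')` of GATE G2-0.
[cite: Verma2004MHDTurbulencePhysRep, §3.3] -/
theorem flux_eq_shellTransfer (I O : Finset (Fin 3 → ℤ)) (h : Disjoint I O) :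
    -(∑ k ∈ I, energyRate U (I ∪ O) k) = shellTransfer U O I := by
  have h1 : ∑ k ∈ I, energyRate U (I ∪ O) k = shellTransfer U I (I ∪ O) := rfl
  rw [h1, shellTransfer_union_right U I I O h, shellTransfer_self, zero_add,
    shellTransfer_antisymm U O I, neg_neg]

/-- The flux out of the inside plus the energy rate of the outside vanish together:
`Σ_{k∈O} energyRate û (I∪O) k = T(I→O)` (what the outside gains is the flux). [folklore] -/
theorem outside_energyRate_eq_shellTransfer (I O : Finset (Fin 3 → ℤ)) (h : Disjoint I O) :
    ∑ k ∈ O, energyRate U (I ∪ O) k = shellTransfer U O I := by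
  have h1 : ∑ k ∈ O, energyRate U (I ∪ O) k = shellTransfer U O (I ∪ O) := rfl
  rw [h1, shellTransfer_union_right U O I O h, shellTransfer_self, add_zero]

/-! ## (v2) `energyRate` IS the advective energy rate of the Galerkin-truncated system -/

/-- The Galerkin-truncated ADVECTION term of the Euler/Navier–Stokes nonlinearity on the mode
set `S`: `N_S(k)_j = -i Σ_{p∈S} (k · û(k-p)) û_j(p)` (the Fourier coefficient at `k` of
`-(u·∇)u` restricted to pairs with `p ∈ S`, using `q·û(p)`-type incompressibility to write
`(u·∇)` as `i k·û(q)`). [cite: Verma2004MHDTurbulencePhysRep, §3.1] -/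
def advection (S : Finset (Fin 3 → ℤ)) (k : Fin 3 → ℤ) : Fin 3 → ℂ :=
  fun j => -I * ∑ p ∈ S, kdot k (U.coeff (k - p)) * U.coeff p j

/-- `conj û(k)` is orthogonal to anything parallel to `k` (incompressibility `k·û(k) = 0`): the
Leray/pressure projection `N ↦ N - ((k·N)/|k|²) k` therefore does not change the energy rate.
[folklore] -/
theorem cdot_conj_coeff_parallel (k : Fin 3 → ℤ) (c : ℂ) :
    cdot (fun i => conj (U.coeff k i)) (fun i => c * ((k i : ℤ) : ℂ)) = 0 := by
  unfold cdot
  have h : ∑ i, conj (U.coeff k i) * (c * ((k i : ℤ) : ℂ)) =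
      c * conj (∑ i, ((k i : ℤ) : ℂ) * U.coeff k i) := by
    rw [map_sum, Finset.mul_sum]
    refine Finset.sum_congr rfl fun i _ => ?_
    rw [map_mul, map_intCast]; ring
  rw [h, U.divFree k, map_zero, mul_zero]

/-- **`energyRate` is the advective rate of change of the modal energy**:
`Σ_{p∈S} modeTransfer û k p = Re( conj û(k) · N_S(k) )`, i.e. `= d/dt ½|û(k)|²` along the
truncated system `dû(k)/dt = P_k N_S(k)` (the projection `P_k` drops out by
`cdot_conj_coeff_parallel`). [cite: Verma2004MHDTurbulencePhysRep, §3.1] -/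
theorem energyRate_eq_re_cdot_advection (S : Finset (Fin 3 → ℤ)) (k : Fin 3 → ℤ) :
    energyRate U S k = (cdot (fun j => conj (U.coeff k j)) (advection U S k)).re := by
  unfold energyRate modeTransfer advection cdot
  -- pull the `p`-sum out of the `j`-sum
  have h : ∑ j, conj (U.coeff k j) * (-I * ∑ p ∈ S, kdot k (U.coeff (k - p)) * U.coeff p j) =
      ∑ p ∈ S, (-I) * (kdot k (U.coeff (k - p)) * ∑ j, conj (U.coeff k j) * U.coeff p j) := by
    simp_rw [Finset.mul_sum]
    rw [Finset.sum_comm]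
    refine Finset.sum_congr rfl fun p _ => ?_
    refine Finset.sum_congr rfl fun j _ => ?_
    ring
  rw [h, Complex.re_sum]
  refine Finset.sum_congr rfl fun p _ => ?_
  rw [Complex.mul_re, Complex.neg_re, Complex.neg_im, Complex.I_re, Complex.I_im]
  ring

/-- With the pressure projection written out: for ANY scalar `c` (e.g. `c = (k·N)/|k|²`),
`Re( conj û(k) · (N_S(k) - c k) ) = energyRate û S k`. [folklore] -/
theorem energyRate_eq_re_cdot_projected (S : Finset (Fin 3 → ℤ)) (k : Fin 3 → ℤ) (c : ℂ) :
    (cdot (fun j => conj (U.coeff k j)) (fun j => advection U S k j - c * ((k j : ℤ) : ℂ))).re =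
      energyRate U S k := by
  have hsplit : cdot (fun j => conj (U.coeff k j)) (fun j => advection U S k j - c * ((k j : ℤ) : ℂ)) =
      cdot (fun j => conj (U.coeff k j)) (advection U S k) -
        cdot (fun j => conj (U.coeff k j)) (fun j => c * ((k j : ℤ) : ℂ)) := by
    unfold cdot
    rw [← Finset.sum_sub_distrib]
    refine Finset.sum_congr rfl fun j _ => ?_
    ring
  rw [hsplit, cdot_conj_coeff_parallel, sub_zero, energyRate_eq_re_cdot_advection]

end ShellTransfer

end Literature.Analysis.FluidPDE.FluidComputer

end
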